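/-
Origin: expansion seat `planner-pub-hodgecm-pv09-g5-0`, handover #2 2026-08-18T09:12:19Z (`HOME/pub-hodgecm-pv09-g5/lean/Pv09g5/GenuineIntertwiner.lean`, md5 439b661b, 210 lines);
landed by the gen-7 packager in gate run 27 as `HodgeCM/PerL34/GenuineIntertwiner.lean` (import ^import Pv[0-9]+g[0-9]+\.→import HodgeCM.PerL34. ×1).
-/
/-
Copyright: HodgeCM publication cell (pub-hodgecm), DAG node N31 (seam S3, PerL v5 Lemma 4.2(b)) — the S3 headline
for the GENUINE unitary torus with the D4 (b) dictionary in PRINT SHAPE.  Prover seat pub-hodgecm-pv09-g5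
(DAG-node prover #09, generation 5; lineage pv09 → g2 → g3 → g4 → g5), file #2 (HANDOVER #2).  Released under
the package licence.

WIP imports: `Pv09g5.GenuineHeadline` ↦ `HodgeCM.PerL34.GenuineHeadline` (this seat, HANDOVER #1, run 27);
tree `HodgeCM.PerL34.NonsplitRamified` (pv13-g3, run 25).  Complete proofs, no new axioms, nothing cited.
-/
import Summits.HodgeConjecture.HodgeCM.PerL34.GenuineHeadline
import Summits.HodgeConjecture.HodgeCM.PerL34.NonsplitRamified

/-!
# The S3 headline for `U(1)_{L/L⁺}(𝔸_{L⁺})` — split places through ISOMETRIC INTERTWINERS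

Text under adjudication (NOT cited), PerL v5 ll. 610–611: at a place `v` of `L⁺` split in `L`,
"`U(W_i)(L_{0,v}) ≅ L_{0,v}^×` acts on the Schrödinger model `𝒮(L_{0,v}^3)` … by `(ω(y)φ)(x) = |y|^{3/2} φ(yx)`
up to a unitary character".

`GenuineHeadline` (#1) states the S3 headline for the genuine torus with that dictionary entered as EQUATIONS on
matrix coefficients: `coeff_eq` (split `v ∉ S`: the coefficients of `φ` along `ϖ_vⁿ` are those of `1_{𝒪_v³}` in the
dilation model) and `coeffS` with a constant `c_v > 0` (split `v ∈ S`).  pv13-g3's `IntertwinerEnd` (run 26) made,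
over an ABSTRACT family of local groups, the move to the statement as printed ([MVW]-shape, pv07-g2
`DilationIntertwiner`): per split place ONE isometric intertwiner `V_v : L²(L_w³) →ₗᵢ Sp` carrying the chosen
local vector (`1_{𝒪³}` off `S`, `a_v • 1_D` on `S`) to `φ` and intertwining `ω ∘ ι_v` with the dilation
representation along an identification `t_v : G_v → L_wˣ` — with `t_v`, `t_v ϖ_v = ϖ^F_v`, `τ_v` still BINDERS.

This file makes the same move AT THE GENUINE TORUS, where the identification is no longer a datum: `t_v = τ_v :=
Genuine.splitTriv v` (pv07-g3 `splitEquiv`, kernel), `ϖ_v := Genuine.unif v`, `ϖ^F_v := Genuine.unifF (placeOf v)`,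
and the compatibility `splitTriv v (unif v) = unifF (placeOf v)` is the new lemma `Genuine.splitTriv_unif` (§1).
The equations `coeff_eq` / `coeffS`, the constant `c_v := ‖a_v‖²` and `0 < c_v` (forced by `‖φ‖ = 1`) are DERIVED
(tree `SplitShells.coeff_zpow_of_intertwiner` / `coeffS_of_intertwiner`, pv13-g3 `NonsplitRamified` §2; §1
`normSq_pos_of_map_smul_eq`).

**Result** `PureTensor.exists_compactDomain_thetaLift_ne_zero_genuine_intertwiner`: the conclusion of #1 verbatim
(compact fundamental domain `𝓕` for `U(1)(L⁺)` in `U(1)(𝔸_{L⁺})`, non-empty interior, positive finite Haar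
measure, theta-lift Petersson pairing over `𝓕` against `χ` non-zero) from REPRESENTATION-side binders only, now in
print shape: the doubling / theta data `D GU (W,h) j χ φ` with `hj hχΓ hχVΓ P hφ hloc hχT' hlocχ hK hM hTS hT'S`;
the local unitary characters `ν_v` (`hν`: unramified at split `v ∉ S`); at split `v ∉ S` the intertwiner
`VU_v` on `1_{𝒪³}` (`hVUψ`, `hVU`); at split `v ∈ S` the ball `D = closedBall x₀_v r_v` and scalar `a_v`
(`hr hr0 hνS hχS` — the "N large" CHOICE of print) and the intertwiner `VS_v` on `a_v • 1_D` (`hVSψ`, `hVS`); at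
non-split `v ∈ S` (all infinite places included) the isotypy `hiso`; plus the bookkeeping `hS` (infinite places in
`S`) and the σ-algebra / decidability instance binders of #1.  NO identification datum (`tU htU τ τU hτUB ord ϖ ϖF`)
remains.

Nothing is cited; PerL v5 ll. 600–640 is the USE of this statement.
-/

set_option autoImplicit false

noncomputable section

open MeasureTheory MeasureTheory.Measure Set Metric Function Complex ComplexConjugate Topology
open scoped RestrictedProduct InnerProductSpace NNReal ENNReal

/-! ## §1  Two lemmas -/

namespace HodgeCM.PerL34.IdelicTorusModel

namespace Genuine

open IdelePlaces RestrictedRegroup RestrictedCutout NumberField IsDedekindDomain Sum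
open HodgeCM.PerL34.LocalFactors.DilationModel

attribute [local instance] LocalFactors.DilationModel.Adic.nontriviallyNormedField
  LocalFactors.DilationModel.Adic.properSpace

variable (L : Type) [Field L] [NumberField L] [IsCMField L]

local notation3 "L⁺" => maximalRealSubfield L

/-- **Compatibility of the genuine identification with the genuine uniformizers**: at a split place the chart
`splitTriv v : U(1)_v ≃ₜ* L_wˣ` carries `unif v` (:= pv07-g3 `splitUnif (unifF w)` = the chart's preimage of
`unifF w`) to `unifF w`, `w = placeOf v`.  This is the binder `htU : tU_v ϖ_v = ϖ^F_v` of pv13-g3's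
`IntertwinerEnd`, now a theorem. -/
theorem splitTriv_unif : ∀ (i : Place L⁺) (hs : IsSplitPlace L i), splitTriv L i hs (unif L i) = unifF L (placeOf L i)
  | inl _, hs => hs.elim
  | inr v, hs => by
    simp only [splitTriv, unif, dif_pos hs, splitUnif]
    exact (splitEquiv (IsCMField.complexConj L) (placeOver_under L v) (eq_one_or_eq_complexConj L) hs).apply_symm_apply _

end Genuine

end HodgeCM.PerL34.IdelicTorusModel

namespace HodgeCM.PerL34.PureTensor

/-- `‖φ‖ = 1` and `V (a • ψ) = φ` for a linear isometry `V` force `a ≠ 0`, i.e. `0 < ‖a‖²` (the constant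
`c_v := ‖a_v‖²` of `coeffS` is positive; cf. pv13-g3 `SplitShells.normSq_pos_of_intertwiner`). -/
theorem normSq_pos_of_map_smul_eq {X Sp : Type*} [NormedAddCommGroup X] [InnerProductSpace ℂ X]
    [NormedAddCommGroup Sp] [InnerProductSpace ℂ Sp] (V : X →ₗᵢ[ℂ] Sp) {a : ℂ} {ψ : X} {φ : Sp}
    (hV : V (a • ψ) = φ) (hφ : ‖φ‖ = 1) : 0 < ‖a‖ ^ 2 := by
  have hne : a ≠ 0 := by
    rintro rfl
    have hφ0 : φ = 0 := by rw [← hV, zero_smul, map_zero]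
    simp [hφ0] at hφ
  positivity

/-! ## §2  The headline for `U(1)_{L/L⁺}`, intertwiner shape -/

open HodgeCM.PerL34.SplitShells HodgeCM.PerL34.AdelicFactorisation HodgeCM.PerL34.RestrictedMeasure
open HodgeCM.PerL34.NoSmallSubgroups HodgeCM.PerL34.EulerFactorisation HodgeCM.PerL34.DiscreteFD
open HodgeCM.PerL34.LocalFactors HodgeCM.PerL34.LocalFactors.DilationModel
open HodgeCM.PerL34.LocalModulus HodgeCM.PerL34.SplitPlaceDilation
open HodgeCM.PerL34.RallisIP HodgeCM.PerL34.Doubling HodgeCM.PerL34.N31d NumberField IsDedekindDomain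
open HodgeCM.PerL34.IdelePlaces HodgeCM.PerL34.RestrictedRegroup HodgeCM.PerL34.RestrictedCutout
open HodgeCM.PerL34.IdelicTorusModel HodgeCM.PerL34.IdelicTorusModel.Genuine

attribute [local instance] LocalFactors.DilationModel.Adic.nontriviallyNormedField
  LocalFactors.DilationModel.Adic.properSpace

section genuineIntertwiner

variable (L : Type) [Field L] [NumberField L] [IsCMField L]

-- (no `L⁺` notation in this section: a `notation3` token inside `variable` binders does not re-elaborate)

variable [DecidableEq (Place (maximalRealSubfield L))]
  [∀ w : HeightOneSpectrum (𝓞 L), MeasurableSpace (w.adicCompletion L)]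
  [∀ w : HeightOneSpectrum (𝓞 L), BorelSpace (w.adicCompletion L)]
  (S₀ : Finset (Place (maximalRealSubfield L)))
  {Sp : Type} [NormedAddCommGroup Sp] [InnerProductSpace ℂ Sp]
  {W : Type} [AddCommGroup W] [Module L W]
  {H Sbox : Type} [Group H] [AddCommGroup Sbox] [Module ℂ Sbox]
  {h : W →ₗ⋆[L] W →ₗ[L] L} (hW : IsLine L W) (hh : Anisotropic h)
  (D : DoublingDatum (Model L) H Sp Sbox) (GU : ThetaSide Sp Sbox)
  (j : isomBox h →* H) (hj : ∀ d : unitary L, j ⟨iotaSnd d, iotaSnd_mem h d⟩ = D.ι (1, unitaryToModel L d))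
  (χ : Model L →* Circle) (hχΓ : ∀ d : unitary L, χ (unitaryToModel L d) = 1)
  (hχVΓ : ∀ d : unitary L, D.χV (unitaryToModel L d) = 1)
  {hP : ∀ Ψ : Sbox, ∀ p ∈ (stabDelta L W).subgroupOf (isomBox h), ∀ x : H,
    D.fSW Ψ (j p * x) = D.fSW Ψ x}
  (P : GluePrintInputs D GU h j hP) (φ : Sp)
  (hφ : ‖φ‖ = 1)
  (hloc : ∀ (i : Place (maximalRealSubfield L)) (v : Sp),
    Continuous fun g : locTorus (maximalRealSubfield L) L i => D.ω (RestrictedProduct.mulSingle (genLevel L) i g) v)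
  {T' : Finset (Place (maximalRealSubfield L))} (hχT' : RestrictedProduct.boxSubgroup (genLevel L) T' ≤ χ.ker)
  (hlocχ : ∀ i ∈ T', Continuous fun g : locTorus (maximalRealSubfield L) L i => χ (RestrictedProduct.mulSingle (genLevel L) i g))
  {T : Finset (Place (maximalRealSubfield L))} (hK : ∀ k ∈ RestrictedProduct.boxSubgroup (genLevel L) T, D.ω k φ = φ)
  (hM : ∀ S : Finset (Place (maximalRealSubfield L)), T ⊆ S → ∀ y : (i : ↥S) → locTorus (maximalRealSubfield L) L i,
    inner ℂ φ (D.ω (extendOne (genLevel L) S y) φ) = ∏ i : ↥S, localCoeff (genLevel L) D.ω φ i (y i))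
  {S : Finset (Place (maximalRealSubfield L))} (hTS : T ⊆ S) (hT'S : T' ⊆ S)
  -- bookkeeping: `S` contains the infinite places
  (hS : ∀ v : InfinitePlace (maximalRealSubfield L), Sum.inl v ∈ S)
  -- the local unitary characters `ν_v` of `L_wˣ` ("up to a unitary character", l. 611), unramified off `S`
  (ν : ∀ i : Place (maximalRealSubfield L), ((placeOf L i).adicCompletion L)ˣ →* Circle)
  (hν : ∀ i, i ∉ S → IsSplitPlace L i → ∀ u : ((placeOf L i).adicCompletion L)ˣ,
    ‖(u : (placeOf L i).adicCompletion L)‖ = 1 → ν i u = 1)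
  -- split `v ∉ S`: the INTERTWINER on `1_{𝒪_w³}` along the genuine chart `splitTriv`
  (VU : ∀ i, i ∉ S → IsSplitPlace L i → (Lp ℂ 2 (Adic.muV L (placeOf L i)) →ₗᵢ[ℂ] Sp))
  (hVUψ : ∀ i (hi : i ∉ S) (hs : IsSplitPlace L i), VU i hi hs (ballIndicator (Adic.muV L (placeOf L i)) 0 1) = φ)
  (hVU : ∀ i (hi : i ∉ S) (hs : IsSplitPlace L i), ∀ g : locTorus (maximalRealSubfield L) L i,
    D.ω (RestrictedProduct.mulSingle (genLevel L) i g) (VU i hi hs (ballIndicator (Adic.muV L (placeOf L i)) 0 1))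
      = VU i hi hs (dilationRep (Adic.muV L (placeOf L i)) (ν i) (splitTriv L i hs g)
          (ballIndicator (Adic.muV L (placeOf L i)) 0 1)))
  -- split `v ∈ S`: the ball `D = closedBall x₀ r` and scalar `a` (CHOICE, "N large"), and the INTERTWINER on `a • 1_D`
  (x₀ : ∀ i : Place (maximalRealSubfield L), Fin 3 → (placeOf L i).adicCompletion L)
  (r : Place (maximalRealSubfield L) → ℝ) (a : Place (maximalRealSubfield L) → ℂ)
  (hr : ∀ i ∈ S, IsSplitPlace L i → r i < ‖x₀ i‖) (hr0 : ∀ i ∈ S, IsSplitPlace L i → 0 < r i)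
  (hνS : ∀ i ∈ S, IsSplitPlace L i → ∀ y : ((placeOf L i).adicCompletion L)ˣ,
    (y : (placeOf L i).adicCompletion L) ∈ U1 (x₀ i) (r i) → ν i y = 1)
  (hχS : ∀ i (_ : i ∈ S) (hs : IsSplitPlace L i), ∀ g : locTorus (maximalRealSubfield L) L i,
    ((splitTriv L i hs g : ((placeOf L i).adicCompletion L)ˣ) : (placeOf L i).adicCompletion L) ∈ U1 (x₀ i) (r i) →
      χ (RestrictedProduct.mulSingle (genLevel L) i g) = 1)
  (VS : ∀ i, i ∈ S → IsSplitPlace L i → (Lp ℂ 2 (Adic.muV L (placeOf L i)) →ₗᵢ[ℂ] Sp))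
  (hVSψ : ∀ i (hi : i ∈ S) (hs : IsSplitPlace L i),
    VS i hi hs (a i • ballIndicator (Adic.muV L (placeOf L i)) (x₀ i) (r i)) = φ)
  (hVS : ∀ i (hi : i ∈ S) (hs : IsSplitPlace L i), ∀ g : locTorus (maximalRealSubfield L) L i,
    D.ω (RestrictedProduct.mulSingle (genLevel L) i g) (VS i hi hs (a i • ballIndicator (Adic.muV L (placeOf L i)) (x₀ i) (r i)))
      = VS i hi hs (dilationRep (Adic.muV L (placeOf L i)) (ν i) (splitTriv L i hs g)
          (a i • ballIndicator (Adic.muV L (placeOf L i)) (x₀ i) (r i))))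
  -- non-split `v ∈ S` (every infinite place included): isotypy of `φ`
  (hiso : ∀ i ∈ S, ¬IsSplitPlace L i → ∀ g : locTorus (maximalRealSubfield L) L i, D.ω (RestrictedProduct.mulSingle (genLevel L) i g) φ
    = conj (((χ (RestrictedProduct.mulSingle (genLevel L) i g) : Circle) : ℂ)) • φ)

include hW hh hj hχΓ hχVΓ P hφ hloc hK hM hTS hT'S hS hν hVUψ hVU hr hr0 hνS hχS hVSψ hVS hiso

set_option synthInstance.maxHeartbeats 200000 in
-- (as in #1: the `SMul Γ (Model L)` instance behind `IsFundamentalDomain` is slow to find at these concrete types)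
/-- **S3 HEADLINE for the genuine unitary torus `U(1)_{L/L⁺}(𝔸_{L⁺}) ⊇ U(1)(L⁺)` of a CM field `L`, split places
through ISOMETRIC INTERTWINERS (tex ll. 610–611 as printed).**  #1 `exists_compactDomain_thetaLift_ne_zero_genuine`
with its dictionary equations `coeff_eq` (split `v ∉ S`) and `coeffS` / `cS` / `hcS` (split `v ∈ S`) DERIVED from
one isometric intertwiner per split place along the genuine chart `splitTriv_v : U(1)_v ≃ₜ* L_wˣ`; no
identification datum remains. -/
theorem exists_compactDomain_thetaLift_ne_zero_genuine_intertwiner [IsFiniteMeasure GU.μ] :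
    ∃ 𝓕 : Set (Model L), IsCompact 𝓕 ∧ (interior 𝓕).Nonempty ∧ MeasurableSet 𝓕 ∧
      IsFundamentalDomain (unitaryToModel L).range 𝓕 (haarDatum (genLevel L) (isCompact_genLevel L) (isOpen_genLevel L) S₀).μ ∧
      (haarDatum (genLevel L) (isCompact_genLevel L) (isOpen_genLevel L) S₀).μ 𝓕 ≠ 0 ∧
      (haarDatum (genLevel L) (isCompact_genLevel L) (isOpen_genLevel L) S₀).μ 𝓕 ≠ ⊤ ∧
      ∀ [IsFiniteMeasure (((haarDatum (genLevel L) (isCompact_genLevel L) (isOpen_genLevel L) S₀).μ).restrict 𝓕)]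
        (hk : Measurable (Function.uncurry (thetaFn D GU φ))) {Ck : ℝ} (hCk : 0 ≤ Ck)
        (hkC : ∀ q u, ‖thetaFn D GU φ q u‖ ≤ Ck),
        PeterssonFubini.theta GU.μ (((haarDatum (genLevel L) (isCompact_genLevel L) (isOpen_genLevel L) S₀).μ).restrict 𝓕) hk
          (measurable_coe_char (genLevel L) (isOpen_genLevel L) χ hχT' hlocχ) hCk hkC (norm_coe_char_le χ) ≠ 0 :=
  exists_compactDomain_thetaLift_ne_zero_genuine L S₀ hW hh D GU j hj χ hχΓ hχVΓ P φ hφ hloc hχT' hlocχ hK hM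
    hTS hT'S hS ν hν
    (fun i hi hs n => coeff_zpow_of_intertwiner (genLevel L) D.ω φ (Adic.muV L (placeOf L i)) (ν i) i
      (splitTriv L i hs : locTorus (maximalRealSubfield L) L i →* ((placeOf L i).adicCompletion L)ˣ) (unif L i)
      (unifF L (placeOf L i)) (by simpa only [MonoidHom.coe_coe] using splitTriv_unif L i hs) 1 (VU i hi hs)
      (hVUψ i hi hs) (fun g => by simpa only [MonoidHom.coe_coe] using hVU i hi hs g) n)
    x₀ r (fun i => ‖a i‖ ^ 2) hr hr0
    (fun i hi hs => normSq_pos_of_map_smul_eq (VS i hi hs) (hVSψ i hi hs) hφ) hνS hχS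
    (fun i hi hs g => coeffS_of_intertwiner (genLevel L) D.ω φ (Adic.muV L (placeOf L i)) (ν i) i
      (fun g => splitTriv L i hs g) (x₀ i) (r i) (a i) (VS i hi hs) (hVSψ i hi hs) (hVS i hi hs) g)
    hiso

end genuineIntertwiner

end HodgeCM.PerL34.PureTensor

end
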